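import Literature.Probability.RandomPlanarGeometry.LoewnerImageFlowEmpty
import Literature.Probability.RandomPlanarGeometry.LoewnerThrClock
import HarnessLib

/-!
# The piece structure of the remaining hull on a horizon `[0, β]`

Topic `Probability/RandomPlanarGeometry`; theorems only (crux `stmt-CriticalPhenomena-0698`, stub
`stub_isLocal`, through-swallow image chain of the locality of SLE₆: G. F. Lawler (2005), §6.3
Thm. 6.13 — the conformal image `Φ ∘ γ` is followed THROUGH the finitely many instants at which the
hull swallows whole pieces of `A`; Lawler–Schramm–Werner (2003), §5). For a driving function `W` and
a `*`-hull `A`, the remaining hull `t ↦ remHull W A t = A ∖ K̂_t` (`LoewnerRemainingHull.lean`) is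
antitone. On a horizon `[0, β]` on which it is CLOSED-valued (clusterwise swallowing) and takes
FINITELY many values we prove the piece structure used to glue the alive image chains of the pieces:

* `remHull_zero`, `remHull_eq_remHull_diff`, `mem_remHull_iff`, `isStarHull_remHull`,
  `isStarHull_thrSlidHull` — the remaining hull at `0` is `A`, later ones are earlier ones minus the
  closed hull, a closed remaining hull is a `*`-hull (a clopen piece, `IsStarHull.isStarHull_piece`)
  missed by all `K̂_s`, `s ≤ t`, so its slid image `thrSlidHull W A t` is a `*`-hull;
* `exists_Icc_remHull_eq` — **right local constancy**: every `s < β` starts a piece `[s, s']`,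
  `s < s' ≤ β`, of constancy (finiteness + right-continuity of the closed hulls, `exists_horizon`);
* `exists_Ico_remHull_eq` — **left local constancy**: every `0 < s ≤ β` ends a piece `[s₀, s)`;
* `hullHitTime_remHull_eq` — at a jump `s` the previous value `B = remHull W A s₀` is first hit
  by the closed hulls exactly at `s` (and `remHull W A s = B ∖ K̂_s`), the situation of
  `tendsto_starShift_slidHull_hullHitTime` ((W), `LoewnerShiftAtContact.lean`);
* `finite_setOf_isJump`, `exists_nhds_remHull_eq` — the jump times are finitely many (the value
  determines the jump time) and every other interior time has a two-sided piece of constancy;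
* `integrableOn_thrClockRate` — the through-swallow clock rate `d_r² = Φ'_{B_r}(0)²` is integrable
  on `[0, β]` (bounded by `1`, continuous on each of the finitely many order-connected pieces), the
  hypothesis of the clock API `LoewnerThrClock.lean`.
-/

noncomputable section

open Set Filter Topology Function Complex Metric MeasureTheory
open UpperHalfPlane (upperHalfPlaneSet)
open scoped NNReal

namespace Literature.Probability.RandomPlanarGeometry

namespace Loewner

variable {W : ℝ≥0 → ℝ} {A : Set ℂ}

/-! ### The remaining hull: basic facts -/

/-- At time `0` nothing of the `*`-hull `A` is swallowed (`W 0 = 0 ∉ A`). [folklore] -/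
theorem remHull_zero (hW : Continuous W) (hW0 : W 0 = 0) (hA : IsStarHull A) : remHull W A 0 = A :=
  remHull_of_disjoint (disjoint_closedHull_zero_of_isStarHull hW hW0 hA)

/-- A later remaining hull is an earlier one minus the later closed hull. [folklore] -/
theorem remHull_eq_remHull_diff (W : ℝ≥0 → ℝ) (A : Set ℂ) {s t : ℝ≥0} (hst : s ≤ t) :
    remHull W A t = remHull W A s \ closedHull W t := by
  ext z
  simp only [remHull, Set.mem_sdiff]
  constructor
  · rintro ⟨hzA, hzt⟩; exact ⟨⟨hzA, fun h ↦ hzt (closedHull_mono W hst h)⟩, hzt⟩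
  · rintro ⟨⟨hzA, -⟩, hzt⟩; exact ⟨hzA, hzt⟩

/-- A point of `A` remains at time `t` iff it is still flowing at `t`. [folklore] -/
theorem mem_remHull_iff (hA : IsStarHull A) {t : ℝ≥0} {a : ℂ} (ha : a ∈ A) :
    a ∈ remHull W A t ↔ (t : WithTop ℝ≥0) < swallowingTime W a := by
  have him : 0 ≤ a.im := hA.isBoundedHull.im_nonneg ha
  constructor
  · intro h
    by_contra hle
    exact h.2 ⟨him, not_lt.1 hle⟩
  · intro h
    exact ⟨ha, fun hK ↦ hK.2.not_gt h⟩

/-- The swallowed part `A ∖ A_t^rem = A ∩ K̂_t` is closed. [folklore] -/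
theorem isClosed_diff_remHull (hW : Continuous W) (hA : IsStarHull A) (t : ℝ≥0) :
    IsClosed (A \ remHull W A t) := by
  rw [remHull, Set.sdiff_sdiff_right_self]
  exact hA.isBoundedHull.isClosed.inter (isClosed_closedHull hW t)

/-- **A closed remaining hull is a `*`-hull** (a clopen piece of `A`, possibly empty).
[cite: Lawler2005, §6.3 Thm. 6.13] -/
theorem isStarHull_remHull (hW : Continuous W) (hA : IsStarHull A) {t : ℝ≥0}
    (hcl : IsClosed (remHull W A t)) : IsStarHull (remHull W A t) :=
  hA.isStarHull_piece (remHull_subset W A t) hcl (isClosed_diff_remHull hW hA t)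

/-- **The through-swallow slid hull `B_t = g_t(A_t^rem) − W_t` is a `*`-hull** when the remaining
hull is closed (the remaining hull is missed by `K̂_t`, `disjoint_closedHull_remHull`).
[cite: LawlerSchrammWerner2003Restriction, §5 (A_t = g_t(A))] -/
theorem isStarHull_thrSlidHull (hW : Continuous W) (hA : IsStarHull A) {t : ℝ≥0}
    (hcl : IsClosed (remHull W A t)) : IsStarHull (thrSlidHull W A t) :=
  isStarHull_slidHull_of_disjoint hW (isStarHull_remHull hW hA hcl) (disjoint_closedHull_remHull W A le_rfl)

/-- A point remaining at `s < β` still remains a little later (right-continuity of the closed hulls).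
[folklore] -/
theorem exists_mem_remHull_of_mem (hA : IsStarHull A) {s β : ℝ≥0} (hs : s < β) {a : ℂ}
    (ha : a ∈ remHull W A s) : ∃ r : ℝ≥0, s < r ∧ r ≤ β ∧ a ∈ remHull W A r := by
  have haA := remHull_subset W A s ha
  obtain ⟨r, hsr, hrβ, hr⟩ := exists_horizon ((mem_remHull_iff hA haA).1 ha) hs
  exact ⟨r, hsr, hrβ, (mem_remHull_iff hA haA).2 hr⟩

/-! ### Local constancy from finiteness -/

section Pieces

variable (hA : IsStarHull A) {β : ℝ≥0} (hfin : (remHull W A '' Icc 0 β).Finite)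
include hfin

include hA in
/-- **Right local constancy**: every `s < β` starts a piece `[s, s']`, `s < s' ≤ β`, on which the
remaining hull is constant. (Take a maximal value among the later ones; it is taken on a right
neighbourhood `(s, r₀]`, and the union of the later remaining hulls is the one at `s`.)
[cite: Lawler2005, §6.3 Thm. 6.13] -/
theorem exists_Icc_remHull_eq {s : ℝ≥0} (hs : s < β) :
    ∃ s' : ℝ≥0, s < s' ∧ s' ≤ β ∧ ∀ r ∈ Icc s s', remHull W A r = remHull W A s := by
  set F : Set (Set ℂ) := remHull W A '' Ioc s β with hF
  have hFfin : F.Finite := hfin.subset (Set.image_mono fun r hr ↦ ⟨zero_le, hr.2⟩)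
  have hFne : F.Nonempty := ⟨_, β, ⟨hs, le_rfl⟩, rfl⟩
  obtain ⟨V, hVmax⟩ := hFfin.exists_maximal hFne
  obtain ⟨r₀, hr₀, hr₀V⟩ := hVmax.prop
  have hconst : ∀ r ∈ Ioc s r₀, remHull W A r = V := fun r hr ↦ by
    have hmem : remHull W A r ∈ F := ⟨r, ⟨hr.1, hr.2.trans hr₀.2⟩, rfl⟩
    have hge : V ≤ remHull W A r := hr₀V ▸ remHull_anti W A hr.2
    exact hVmax.eq_of_ge hmem hge
  have hsV : remHull W A s = V := by
    refine Subset.antisymm (fun a ha ↦ ?_) (hr₀V ▸ remHull_anti W A hr₀.1.le)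
    obtain ⟨r, hsr, hrr₀, har⟩ := exists_mem_remHull_of_mem hA hr₀.1 ha
    rwa [hconst r ⟨hsr, hrr₀⟩] at har
  refine ⟨r₀, hr₀.1, hr₀.2, fun r hr ↦ ?_⟩
  rcases hr.1.eq_or_lt with h | h
  · rw [h]
  · rw [hconst r ⟨h, hr.2⟩, hsV]

/-- **Left local constancy**: every `0 < s ≤ β` ends a piece `[s₀, s)`, `s₀ < s`, on which the
remaining hull is constant (a minimal value among the earlier ones is taken up to `s`).
[cite: Lawler2005, §6.3 Thm. 6.13] -/
theorem exists_Ico_remHull_eq {s : ℝ≥0} (hs0 : 0 < s) (hs : s ≤ β) :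
    ∃ s₀ : ℝ≥0, s₀ < s ∧ ∀ r ∈ Ico s₀ s, remHull W A r = remHull W A s₀ := by
  set F : Set (Set ℂ) := remHull W A '' Ico 0 s with hF
  have hFfin : F.Finite := hfin.subset (Set.image_mono fun r hr ↦ ⟨hr.1, hr.2.le.trans hs⟩)
  have hFne : F.Nonempty := ⟨_, 0, ⟨le_rfl, hs0⟩, rfl⟩
  obtain ⟨V, hVmin⟩ := hFfin.exists_minimal hFne
  obtain ⟨s₀, hs₀, hs₀V⟩ := hVmin.prop
  refine ⟨s₀, hs₀.2, fun r hr ↦ ?_⟩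
  have hmem : remHull W A r ∈ F := ⟨r, ⟨zero_le, hr.2⟩, rfl⟩
  have hle : remHull W A r ≤ V := hs₀V ▸ remHull_anti W A hr.1
  rw [hs₀V]
  exact hVmin.eq_of_le hmem hle

omit hfin in
/-- On a left piece `[s₀, s)` of constancy, the closed hulls miss the value `remHull W A s₀` strictly
before `s`. [folklore] -/
theorem disjoint_closedHull_of_Ico {s₀ s : ℝ≥0}
    (hconst : ∀ r ∈ Ico s₀ s, remHull W A r = remHull W A s₀) {r : ℝ≥0} (hr : r < s) :
    Disjoint (closedHull W r) (remHull W A s₀) := by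
  rcases le_or_gt s₀ r with h | h
  · rw [← hconst r ⟨h, hr⟩]; exact disjoint_closedHull_remHull W A le_rfl
  · exact disjoint_closedHull_remHull W A h.le

omit hfin in
/-- **At a jump the previous value is first hit exactly at the jump time**: if the remaining hull is
constant `= B` on `[s₀, s)` and different at `s`, then `T_B = hullHitTime W B = s` (and
`remHull W A s = B ∖ K̂_s`, `remHull_eq_remHull_diff`). [cite: Lawler2005, §6.3 Thm. 6.13] -/
theorem hullHitTime_remHull_eq {s₀ s : ℝ≥0} (hs₀ : s₀ < s)
    (hconst : ∀ r ∈ Ico s₀ s, remHull W A r = remHull W A s₀)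
    (hne : remHull W A s ≠ remHull W A s₀) : hullHitTime W (remHull W A s₀) = s := by
  refine le_antisymm (hullHitTime_le fun hdisj ↦ hne ?_) ?_
  · rw [remHull_eq_remHull_diff W A hs₀.le]; exact sdiff_eq_left.2 hdisj.symm
  · by_contra hlt
    obtain ⟨r, hrs, hr⟩ := exists_not_disjoint_of_hullHitTime_lt (not_le.1 hlt)
    exact hr (disjoint_closedHull_of_Ico hconst (WithTop.coe_lt_coe.1 hrs))

/-- **The jump times are finitely many**: a time `s ≤ β` at which no left piece of constancy ends
with the same value is determined by its value `remHull W A s` (between two such times with the same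
value the remaining hull is constant, so the later one is not a jump). [cite: Lawler2005, §6.3 Thm. 6.13] -/
theorem finite_setOf_isJump :
    {s : ℝ≥0 | s ≤ β ∧ ∀ s₀ < s, ∃ r ∈ Ico s₀ s, remHull W A r ≠ remHull W A s}.Finite := by
  set J := {s : ℝ≥0 | s ≤ β ∧ ∀ s₀ < s, ∃ r ∈ Ico s₀ s, remHull W A r ≠ remHull W A s} with hJ
  have himg : (remHull W A '' J).Finite := hfin.subset (Set.image_mono fun s hs ↦ ⟨zero_le, hs.1⟩)
  refine himg.of_finite_image fun s₁ hs₁ s₂ hs₂ heq ↦ ?_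
  by_contra hne
  wlog hlt : s₁ < s₂ generalizing s₁ s₂
  · exact this s₂ hs₂ s₁ hs₁ heq.symm (Ne.symm hne) (lt_of_le_of_ne (not_lt.1 hlt) (Ne.symm hne))
  obtain ⟨r, hr, hrne⟩ := hs₂.2 s₁ hlt
  refine hrne (Subset.antisymm ?_ (remHull_anti W A hr.2.le))
  rw [← heq]; exact remHull_anti W A hr.1

include hA in
/-- **Interior non-jump times are regular**: if `0 < s < β` ends a left piece of constancy with the
same value at `s`, then the remaining hull is constant on a two-sided piece `[s₀, s']`,
`s₀ < s < s' ≤ β`. [folklore] -/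
theorem exists_nhds_remHull_eq {s : ℝ≥0} (hs : s < β)
    (hnoj : ∃ s₀ < s, ∀ r ∈ Ico s₀ s, remHull W A r = remHull W A s) :
    ∃ s₀ s' : ℝ≥0, s₀ < s ∧ s < s' ∧ s' ≤ β ∧ ∀ r ∈ Icc s₀ s', remHull W A r = remHull W A s := by
  obtain ⟨s₀, hs₀, hleft⟩ := hnoj
  obtain ⟨s', hss', hs'β, hright⟩ := exists_Icc_remHull_eq hA hfin hs
  refine ⟨s₀, s', hs₀, hss', hs'β, fun r hr ↦ ?_⟩
  rcases lt_or_ge r s with h | h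
  · exact hleft r ⟨hr.1, h⟩
  · exact hright r ⟨h, hr.2⟩

end Pieces

/-! ### Integrability of the through-swallow clock rate -/

/-- **The through-swallow clock rate is integrable on `[0, β]`** when the remaining hull is closed
on `[0, β]` and takes finitely many values there: `[0, β]` is the finite union of the order-connected
(hence measurable) pieces `{r | remHull W A r⁺ = V}`, on each of which the rate is the alive clock
rate `d_r² = Φ'_{g_r(V) − W_r}(0)²` of the fixed `*`-hull `V`, continuous
(`continuousWithinAt_starDeriv_slidHull'`) and bounded by `1`. [cite: Lawler2005, Prop. 4.41] -/
theorem integrableOn_thrClockRate (hW : Continuous W) (hA : IsStarHull A) {β : ℝ≥0}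
    (hcl : ∀ t ≤ β, IsClosed (remHull W A t)) (hfin : (remHull W A '' Icc 0 β).Finite) :
    IntegrableOn (thrClockRate W A) (Icc (0 : ℝ) β) := by
  set J : Set ℂ → Set ℝ := fun V ↦ {r : ℝ | r ∈ Icc (0 : ℝ) β ∧ remHull W A r.toNNReal = V} with hJ
  have hle : ∀ {r : ℝ}, r ∈ Icc (0 : ℝ) β → r.toNNReal ≤ β := fun hr ↦ by
    rw [← NNReal.coe_le_coe, Real.coe_toNNReal _ hr.1]; exact hr.2
  have hcover : Icc (0 : ℝ) β = ⋃ V ∈ remHull W A '' Icc 0 β, J V := by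
    ext r
    simp only [mem_iUnion, exists_prop]
    constructor
    · intro hr
      exact ⟨_, ⟨r.toNNReal, ⟨zero_le, hle hr⟩, rfl⟩, hr, rfl⟩
    · rintro ⟨V, -, hr, -⟩; exact hr
  rw [hcover, integrableOn_finite_biUnion hfin]
  rintro V ⟨t, ht, rfl⟩
  set B := remHull W A t with hBdef
  have hB : IsStarHull B := isStarHull_remHull hW hA (hcl t ht.2)
  -- the piece is order-connected, hence measurable
  have hJoc : (J B).OrdConnected := by
    refine ⟨fun r₁ hr₁ r₂ hr₂ r hr ↦ ⟨⟨hr₁.1.1.trans hr.1, hr.2.trans hr₂.1.2⟩, ?_⟩⟩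
    refine Subset.antisymm ?_ ?_
    · rw [← hr₁.2]; exact remHull_anti W A (Real.toNNReal_le_toNNReal hr.1)
    · rw [← hr₂.2]; exact remHull_anti W A (Real.toNNReal_le_toNNReal hr.2)
  have hJmeas : MeasurableSet (J B) := hJoc.measurableSet
  -- on the piece the rate is the alive clock rate of `B`, continuous
  have halive : ∀ r ∈ J B, Disjoint (closedHull W r.toNNReal) B := fun r hr ↦ by
    rw [← hr.2]; exact disjoint_closedHull_remHull W A le_rfl
  have hcont : ContinuousOn (thrClockRate W A) (J B) := by
    intro r hr
    have h1 : ContinuousWithinAt (fun v : ℝ≥0 ↦ starDeriv (slidHull W B v))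
        {v | Disjoint (closedHull W v) B} r.toNNReal :=
      continuousWithinAt_starDeriv_slidHull' hW hB (halive r hr)
    have h2 : ContinuousWithinAt (fun r' : ℝ ↦ starDeriv (slidHull W B r'.toNNReal) ^ 2) (J B) r :=
      (h1.comp continuous_real_toNNReal.continuousWithinAt fun r' hr' ↦ halive r' hr').pow 2
    refine h2.congr (fun r' hr' ↦ ?_) ?_
    · exact thrClockRate_eq_imageClockRate_remHull hr'.2
    · exact thrClockRate_eq_imageClockRate_remHull hr.2
  -- bounded by `1` on a set of finite measure
  have hμ : volume (J B) < ⊤ :=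
    (measure_mono fun r hr ↦ hr.1).trans_lt measure_Icc_lt_top
  have hconst : IntegrableOn (fun _ : ℝ ↦ (1 : ℝ)) (J B) volume := integrableOn_const hμ.ne
  refine Integrable.mono' hconst (hcont.aestronglyMeasurable hJmeas) ?_
  filter_upwards with r
  rw [Real.norm_eq_abs, abs_of_pos (thrClockRate_pos_le_one W A r).1]
  exact (thrClockRate_pos_le_one W A r).2

end Loewner

end Literature.Probability.RandomPlanarGeometry

end
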